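import Literature.NumberTheory.GaloisRepresentations.GlobalClassFieldConjugateProofs
import Literature.NumberTheory.GaloisRepresentations.GlobalArtinMapGaloisEquivarianceProofs
import Literature.NumberTheory.GaloisRepresentations.GlobalReciprocityLawProofs
import HarnessLib

/-!
# Galois equivariance of the universal norm residue symbol `( , K') = lim ψ_{L|K'}`
# (Tate, Cassels–Fröhlich VII 11.5 at the limit 5.4): `(σ x, K') = ρ (x, K') ρ⁻¹`

Topic `NumberTheory/GaloisRepresentations` (global class field theory); namespace
`Literature.NumberTheory.GaloisRepresentations`.  Proof file: theorems only, no definition, no named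
fact, no instance (D-0026).

Setting: `K ⊆ K'` with `K'|K` finite Galois, `K'` a number field, `K̄' = AlgebraicClosure K'`,
`ρ ∈ Aut_K(K̄')` with `σ = ρ|_{K'} ∈ G(K'|K)`.  The tree has the finite-level transport of the Artin
map for every finite abelian `L ⊆ K̄'` (`artinIdeleMap_conjField_smul`,
`GlobalClassFieldConjugateProofs`: `ψ_{ρL|K'}(σ • x) = ρ ψ_{L|K'}(x) ρ⁻¹`, Tate VII 11.5 by uniqueness
of the Artin map) and the characterisation of the limit symbol
`θ = (isGlobalReciprocitySystem_artinMap K').theta : C_{K'} → Γ_{K'}^{ab}` by its finite levels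
(`IsCompatibleSystem.absGaloisAbProj_eq_theta_iff`, `GlobalReciprocityFiniteLevelProofs`).  This file
assembles the two into the statement at the limit `( , K') = lim ψ_{L|K'}` (Tate 5.4):

> **Tate, Cassels–Fröhlich VII, Thm. 11.5** (PDF p. 236), in the form used in §12 (p. 239–240),
> "`ψ(σ x) = σ ψ(x) σ⁻¹`": the Artin map is transported by isomorphisms of fields.

* (private helpers) `restrictNormalHom_conjField_conjRestrict` — `(ρ γ ρ⁻¹)|_{ρL} = ρ ∘ γ|_L ∘ ρ⁻¹`
  (Galois theory); `le_conjField_conjField_symm` — `L₁ ≤ ρ (ρ⁻¹ L₁)`;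
* **`conjRestrict_mem_reps_smul`** — if `γ ∈ Γ_{K'}` represents `θ [x]` (`γ|_L = ψ_{L|K'}(x)` for every
  finite abelian `L`), then `ρ γ ρ⁻¹` represents `θ [σ • x]`;
* **`absGaloisAbProj_conjRestrict_eq_theta_smul`** (and the `⁻¹`-normalised
  `absGaloisAbProj_conjRestrict_eq_theta_smul_inv`) — `[γ] = θ [x] → [ρ γ ρ⁻¹] = θ [σ • x]` in
  `Γ_{K'}^{ab}`, for the tree's unconditional Artin system `isGlobalReciprocitySystem_artinMap K'`.

## References

* J. Tate, *Global class field theory*, Ch. VII in J. W. S. Cassels, A. Fröhlich (eds.), *Algebraic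
  Number Theory*, Academic Press 1967, Thm. 11.5 (PDF p. 236), 5.4 (PDF p. 213), §12 (PDF pp. 239–240).
  [CasselsFrohlichANT1967]
* J. Neukirch, *Class Field Theory — The Bonn Lectures*, ed. A. Schmidt, Springer 2013, Part III §6,
  p. 169–170 (the universal norm residue symbol). [Neukirch2013]
-/

noncomputable section

open scoped NumberField Pointwise
open NumberField Field
open Literature.NumberTheory.Automorphic

namespace Literature.NumberTheory.GaloisRepresentations

section ThetaConj

variable {K : Type} [Field K] {K' : Type} [Field K'] [Algebra K K'] [IsGalois K K']

/-- **`(ρ γ ρ⁻¹)|_{ρL} = ρ ∘ γ|_L ∘ ρ⁻¹`**: restricting the conjugate `ρ γ ρ⁻¹ ∈ Γ_{K'}` of `γ` by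
`ρ ∈ Aut_K(K̄')` to the conjugate field `ρ L` is the `ρ`-semilinear conjugate of `γ|_L`.
[folklore] -/
private theorem restrictNormalHom_conjField_conjRestrict
    (ρ : (AlgebraicClosure K') ≃ₐ[K] (AlgebraicClosure K'))
    (γ : (AlgebraicClosure K') ≃ₐ[K'] (AlgebraicClosure K'))
    (L : IntermediateField K' (AlgebraicClosure K')) [Normal K' L] :
    haveI := normal_conjField ρ L
    AlgEquiv.restrictNormalHom (conjField ρ L) (conjRestrict ρ γ) =
      semilinearConj (conjFieldEquiv ρ L) (ρ.restrictNormal K') (conjFieldEquiv_semilinear ρ L)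
        (AlgEquiv.restrictNormalHom L γ) := by
  haveI := normal_conjField ρ L
  apply AlgEquiv.ext
  intro x
  apply Subtype.ext
  have h1 : (((AlgEquiv.restrictNormalHom (conjField ρ L) (conjRestrict ρ γ)) x : conjField ρ L) :
      AlgebraicClosure K') = conjRestrict ρ γ (x : AlgebraicClosure K') :=
    AlgEquiv.restrictNormal_commutes (conjRestrict ρ γ) (conjField ρ L) x
  have h2 : (((AlgEquiv.restrictNormalHom L γ) ((conjFieldEquiv ρ L).symm x) : L) : AlgebraicClosure K') =
      γ (((conjFieldEquiv ρ L).symm x : L) : AlgebraicClosure K') :=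
    AlgEquiv.restrictNormal_commutes γ L _
  rw [h1, conjRestrict_apply]
  change ρ (γ (ρ.symm (x : AlgebraicClosure K'))) =
    ρ ((((AlgEquiv.restrictNormalHom L γ) ((conjFieldEquiv ρ L).symm x) : L) : AlgebraicClosure K'))
  rw [h2]
  rfl

/-- `L₁ ≤ ρ (ρ⁻¹ L₁)` (in fact equality). [folklore] -/
private theorem le_conjField_conjField_symm (ρ : (AlgebraicClosure K') ≃ₐ[K] (AlgebraicClosure K'))
    (L₁ : IntermediateField K' (AlgebraicClosure K')) :
    L₁ ≤ conjField ρ (conjField ρ.symm L₁) := by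
  intro z hz
  refine mem_conjField_iff.mpr ⟨ρ.symm z, mem_conjField_iff.mpr ⟨z, hz, rfl⟩, ?_⟩
  exact ρ.apply_symm_apply z

variable [NumberField K'] [FiniteDimensional K K']

/-- **`ρ γ ρ⁻¹` represents `θ [σ • x]` if `γ` represents `θ [x]`** (`σ = ρ|_{K'}`): if
`γ|_L = ψ_{L|K'}(x)` for every finite abelian `L ⊆ K̄'`, then `(ρ γ ρ⁻¹)|_{L₁} = ψ_{L₁|K'}(σ • x)` for
every finite abelian `L₁` — by Tate VII 11.5 on `L := ρ⁻¹ L₁` (`artinIdeleMap_conjField_smul`) and the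
compatibility of the Artin maps in `L₁ ≤ ρ ρ⁻¹ L₁`.
[cite: CasselsFrohlichANT1967, Ch. VII Thm. 11.5 (PDF p. 236)] -/
theorem conjRestrict_mem_reps_smul (hR : artinReciprocity_character)
    (ρ : (AlgebraicClosure K') ≃ₐ[K] (AlgebraicClosure K')) (x : ideleGroup K')
    (γ : absoluteGaloisGroup K')
    (hγ : γ ∈ (isCompatibleSystem_artinMapFamily (K := K') hR).Reps (QuotientGroup.mk x)) :
    (absoluteGaloisGroup.toAlgEquiv K').symm (conjRestrict ρ (absoluteGaloisGroup.toAlgEquiv K' γ)) ∈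
      (isCompatibleSystem_artinMapFamily (K := K') hR).Reps
        (QuotientGroup.mk (ρ.restrictNormal K' • x)) := by
  intro L₁ _ _
  haveI : NumberField L₁ := NumberField.of_module_finite K' L₁
  -- `L := ρ⁻¹ L₁`, `L' := ρ L ⊇ L₁`
  set L : IntermediateField K' (AlgebraicClosure K') := conjField ρ.symm L₁ with hLdef
  have hL := hγ L
  rw [artinMapFamily_eq hR L, artinClassMap_mk] at hL
  have hL' : AlgEquiv.restrictNormalHom (conjField ρ L)
      (absoluteGaloisGroup.toAlgEquiv K'
        ((absoluteGaloisGroup.toAlgEquiv K').symm (conjRestrict ρ (absoluteGaloisGroup.toAlgEquiv K' γ)))) =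
      artinMapFamily K' hR (conjField ρ L) (QuotientGroup.mk (ρ.restrictNormal K' • x)) := by
    rw [MulEquiv.apply_symm_apply, artinMapFamily_eq hR (conjField ρ L), artinClassMap_mk,
      artinIdeleMap_conjField_smul L hR ρ x, restrictNormalHom_conjField_conjRestrict ρ _ L, hL]
  exact (isCompatibleSystem_artinMapFamily (K := K') hR).compatible L₁ (conjField ρ L)
    (le_conjField_conjField_symm ρ L₁) _ _ hL'

/-- **Galois equivariance of the universal norm residue symbol (Tate VII 11.5 at the limit 5.4)**:
for `ρ ∈ Aut_K(K̄')`, `σ = ρ|_{K'}`, `x ∈ 𝕀_{K'}` and `γ ∈ Γ_{K'}` with `[γ] = (x, K')` in `Γ_{K'}^{ab}`,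
the conjugate `ρ γ ρ⁻¹` satisfies `[ρ γ ρ⁻¹] = (σ • x, K')` — i.e. `( , K')` is transported by the
field automorphism `ρ` (for the tree's unconditional Artin system `isGlobalReciprocitySystem_artinMap`).
[cite: CasselsFrohlichANT1967, Ch. VII Thm. 11.5 (PDF p. 236) and 5.4 (PDF p. 213)] -/
theorem absGaloisAbProj_conjRestrict_eq_theta_smul
    (ρ : (AlgebraicClosure K') ≃ₐ[K] (AlgebraicClosure K')) (x : ideleGroup K')
    (γ : absoluteGaloisGroup K')
    (hγ : absGaloisAbProj K' γ = (isGlobalReciprocitySystem_artinMap K').theta (QuotientGroup.mk x)) :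
    absGaloisAbProj K'
        ((absoluteGaloisGroup.toAlgEquiv K').symm (conjRestrict ρ (absoluteGaloisGroup.toAlgEquiv K' γ))) =
      (isGlobalReciprocitySystem_artinMap K').theta (QuotientGroup.mk (ρ.restrictNormal K' • x)) := by
  rw [(isGlobalReciprocitySystem_artinMap K').toIsCompatibleSystem.absGaloisAbProj_eq_theta_iff] at hγ ⊢
  exact conjRestrict_mem_reps_smul artinReciprocity_character_holds ρ x γ hγ

/-- The same with `γ⁻¹`-normalisation, as used by `IsArtinCorrespondent` (`[γ] = θ(s)⁻¹`):
`[γ] = θ[x]⁻¹ → [ρ γ ρ⁻¹] = θ[σ • x]⁻¹`. [cite: CasselsFrohlichANT1967, Ch. VII Thm. 11.5 (PDF p. 236)] -/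
theorem absGaloisAbProj_conjRestrict_eq_theta_smul_inv
    (ρ : (AlgebraicClosure K') ≃ₐ[K] (AlgebraicClosure K')) (x : ideleGroup K')
    (γ : absoluteGaloisGroup K')
    (hγ : absGaloisAbProj K' γ = ((isGlobalReciprocitySystem_artinMap K').theta (QuotientGroup.mk x))⁻¹) :
    absGaloisAbProj K'
        ((absoluteGaloisGroup.toAlgEquiv K').symm (conjRestrict ρ (absoluteGaloisGroup.toAlgEquiv K' γ))) =
      ((isGlobalReciprocitySystem_artinMap K').theta (QuotientGroup.mk (ρ.restrictNormal K' • x)))⁻¹ := by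
  have hγ' : absGaloisAbProj K' γ⁻¹ =
      (isGlobalReciprocitySystem_artinMap K').theta (QuotientGroup.mk x) := by
    rw [map_inv, hγ, inv_inv]
  have h := absGaloisAbProj_conjRestrict_eq_theta_smul ρ x γ⁻¹ hγ'
  have hinv : (absoluteGaloisGroup.toAlgEquiv K').symm
        (conjRestrict ρ (absoluteGaloisGroup.toAlgEquiv K' γ⁻¹)) =
      ((absoluteGaloisGroup.toAlgEquiv K').symm
        (conjRestrict ρ (absoluteGaloisGroup.toAlgEquiv K' γ)))⁻¹ := by
    change (absoluteGaloisGroup.toAlgEquiv K').symm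
        (conjRestrictHom ρ ((absoluteGaloisGroup.toAlgEquiv K' γ)⁻¹)) = _
    rw [map_inv, map_inv]
    rfl
  rw [hinv, map_inv] at h
  exact inv_eq_iff_eq_inv.mp h

end ThetaConj

end Literature.NumberTheory.GaloisRepresentations

end
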